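import Mathlib
import Literature.Analysis.FluidPDE.CompressibleEulerImplosionMonatomicAlgebra
import Literature.Analysis.ODE.HolomorphicPicardDisc
import HarnessLib

/-!
# Buckmaster–Cao-Labora–Gómez-Serrano at `γ = 5/3`: the self-similar field in COMPLEX time, and its Lipschitz constant on a certified tube

The profile ODE (1.8) of Buckmaster–Cao-Labora–Gómez-Serrano, `W′ = N_W/D_W`, `Z′ = N_Z/D_Z` (`…MonatomicAlgebra`: `DW, DZ, NW, NZ` over `ℝ`), continued to
complex values of `(W, Z)`: the analytic continuation of the smooth profile into a complex neighbourhood of the real core (the "sonic wedge" of the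
spectral argument) solves the SAME rational system with `(W, Z) ∈ ℂ²`. This file provides what the a-posteriori disc theorem
`Literature.Analysis.ODE.exists_holomorphic_solution_in_tube` needs about this particular field:
* `cDW, cDZ, cNW, cNZ, cfield` (the complexified field on `ℂ × ℂ`, agreeing with the real one on real points: `cfield_ofReal`);
* `regSet` (`D_W ≠ 0 ∧ D_Z ≠ 0`, open) and the holomorphy `differentiableOn_cfield`;
* the CERTIFIED TUBE SET `tubeSet M_W M_Z d_W d_Z = {|W| ≤ M_W, |Z| ≤ M_Z, |D_W| ≥ d_W, |D_Z| ≥ d_Z}` (deliberately NOT a polydisc: near the sonic point a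
  polydisc hull of a disc's range meets `D_Z = 0`) and the EXPLICIT Lipschitz constant `lipK r M_W M_Z d_W d_Z` with `lipschitz_cfield`:
  `‖F u − F v‖ ≤ lipK · ‖u − v‖` on the tube set (sup norm of `ℂ × ℂ`), by the algebraic identity
  `N(u)/D(u) − N(v)/D(v) = (N(u)(D(v) − D(u)) + D(u)(N(u) − N(v)))/(D(u)D(v))` — no convexity, no derivatives.
A disc certificate then only has to check rational inequalities (sup of `|ŷ|`, inf of `|D ∘ ŷ|` over the disc, defect) — see the module docstring of
`HolomorphicPicardDisc`. Everything is proved; no facts.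
[cite: BuckmasterCaolaboraGomezserrano2025, §1.3 eq. (1.8), §2.1; Hille1976, §2.3]
-/

noncomputable section

open Set Metric

namespace Literature.Analysis.FluidPDE

namespace BuckmasterCaolaboraGomezserrano2025

namespace Monatomic

namespace ComplexDisc

/-! ### The complexified field -/

/-- `D_W = 1 + (2W + Z)/3` on `ℂ²`. [cite: BuckmasterCaolaboraGomezserrano2025, §1.3 eq. (1.8)] -/
def cDW (W Z : ℂ) : ℂ := 1 + (2 * W + Z) / 3

/-- `D_Z = 1 + (W + 2Z)/3` on `ℂ²`. [cite: BuckmasterCaolaboraGomezserrano2025, §1.3 eq. (1.8)] -/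
def cDZ (W Z : ℂ) : ℂ := 1 + (W + 2 * Z) / 3

/-- `N_W = −(r + 5W/6 + Z/3)W + Z²/6` on `ℂ²`. [cite: BuckmasterCaolaboraGomezserrano2025, §1.3 eq. (1.8)] -/
def cNW (r : ℝ) (W Z : ℂ) : ℂ := -((r : ℂ) + 5 * W / 6 + Z / 3) * W + Z ^ 2 / 6

/-- `N_Z = −(r + W/3 + 5Z/6)Z + W²/6` on `ℂ²`. [cite: BuckmasterCaolaboraGomezserrano2025, §1.3 eq. (1.8)] -/
def cNZ (r : ℝ) (W Z : ℂ) : ℂ := -((r : ℂ) + W / 3 + 5 * Z / 6) * Z + W ^ 2 / 6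

/-- The complexified field `F(W, Z) = (N_W/D_W, N_Z/D_Z)`. [cite: BuckmasterCaolaboraGomezserrano2025, §1.3 eq. (1.8)] -/
def cfield (r : ℝ) (p : ℂ × ℂ) : ℂ × ℂ := (cNW r p.1 p.2 / cDW p.1 p.2, cNZ r p.1 p.2 / cDZ p.1 p.2)

/-- On real points the complexified quantities are the real ones. [folklore] -/
theorem cDW_ofReal (W Z : ℝ) : cDW W Z = (DW W Z : ℂ) := by unfold cDW DW; push_cast; ring

/-- [folklore] -/
theorem cDZ_ofReal (W Z : ℝ) : cDZ W Z = (DZ W Z : ℂ) := by unfold cDZ DZ; push_cast; ring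

/-- [folklore] -/
theorem cNW_ofReal (r W Z : ℝ) : cNW r W Z = (NW r W Z : ℂ) := by unfold cNW NW; push_cast; ring

/-- [folklore] -/
theorem cNZ_ofReal (r W Z : ℝ) : cNZ r W Z = (NZ r W Z : ℂ) := by unfold cNZ NZ; push_cast; ring

/-- [folklore] -/
theorem cfield_ofReal (r W Z : ℝ) :
    cfield r ((W : ℂ), (Z : ℂ)) = (((NW r W Z / DW W Z : ℝ) : ℂ), ((NZ r W Z / DZ W Z : ℝ) : ℂ)) := by
  simp only [cfield, cDW_ofReal, cDZ_ofReal, cNW_ofReal, cNZ_ofReal, Complex.ofReal_div]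

/-! ### Holomorphy off the singular lines -/

/-- The regular set `{D_W ≠ 0, D_Z ≠ 0}`. [folklore] -/
def regSet : Set (ℂ × ℂ) := {p | cDW p.1 p.2 ≠ 0 ∧ cDZ p.1 p.2 ≠ 0}

/-- [folklore] -/
theorem continuous_cDW : Continuous fun p : ℂ × ℂ => cDW p.1 p.2 := by unfold cDW; fun_prop

/-- [folklore] -/
theorem continuous_cDZ : Continuous fun p : ℂ × ℂ => cDZ p.1 p.2 := by unfold cDZ; fun_prop

/-- The regular set is open. [folklore] -/
theorem isOpen_regSet : IsOpen regSet :=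
  (isOpen_ne_fun continuous_cDW continuous_const).inter (isOpen_ne_fun continuous_cDZ continuous_const)

/-- [folklore] -/
theorem differentiable_cDW : Differentiable ℂ fun p : ℂ × ℂ => cDW p.1 p.2 := by unfold cDW; fun_prop

/-- [folklore] -/
theorem differentiable_cDZ : Differentiable ℂ fun p : ℂ × ℂ => cDZ p.1 p.2 := by unfold cDZ; fun_prop

/-- [folklore] -/
theorem differentiable_cNW (r : ℝ) : Differentiable ℂ fun p : ℂ × ℂ => cNW r p.1 p.2 := by unfold cNW; fun_prop

/-- [folklore] -/
theorem differentiable_cNZ (r : ℝ) : Differentiable ℂ fun p : ℂ × ℂ => cNZ r p.1 p.2 := by unfold cNZ; fun_prop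

/-- **The complexified field is holomorphic off the singular lines.** [cite: Hille1976, §2.3] -/
theorem differentiableOn_cfield (r : ℝ) : DifferentiableOn ℂ (cfield r) regSet := by
  intro p hp
  have h1 : DifferentiableAt ℂ (fun p : ℂ × ℂ => cNW r p.1 p.2 * (cDW p.1 p.2)⁻¹) p :=
    ((differentiable_cNW r) p).mul ((differentiable_cDW p).fun_inv hp.1)
  have h2 : DifferentiableAt ℂ (fun p : ℂ × ℂ => cNZ r p.1 p.2 * (cDZ p.1 p.2)⁻¹) p :=
    ((differentiable_cNZ r) p).mul ((differentiable_cDZ p).fun_inv hp.2)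
  have e : cfield r = fun p : ℂ × ℂ => (cNW r p.1 p.2 * (cDW p.1 p.2)⁻¹, cNZ r p.1 p.2 * (cDZ p.1 p.2)⁻¹) := by
    funext p; simp only [cfield, div_eq_mul_inv]
  rw [e]
  exact (h1.prodMk h2).differentiableWithinAt

/-! ### The certified tube set and the Lipschitz constant -/

/-- The tube set of a disc certificate: `|W| ≤ M_W`, `|Z| ≤ M_Z`, `|D_W| ≥ d_W`, `|D_Z| ≥ d_Z`. [folklore] -/
def tubeSet (MW MZ dW dZ : ℝ) : Set (ℂ × ℂ) :=
  {p | ‖p.1‖ ≤ MW ∧ ‖p.2‖ ≤ MZ ∧ dW ≤ ‖cDW p.1 p.2‖ ∧ dZ ≤ ‖cDZ p.1 p.2‖}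

/-- The tube set lies in the regular set when `d_W, d_Z > 0`. [folklore] -/
theorem tubeSet_subset_regSet {MW MZ dW dZ : ℝ} (hW : 0 < dW) (hZ : 0 < dZ) : tubeSet MW MZ dW dZ ⊆ regSet := by
  intro p hp
  refine ⟨fun h => ?_, fun h => ?_⟩
  · have := hp.2.2.1; rw [h, norm_zero] at this; linarith
  · have := hp.2.2.2; rw [h, norm_zero] at this; linarith

/-- Sup bound of `|N_W|` on the tube set. [folklore] -/
def supNW (r MW MZ : ℝ) : ℝ := |r| * MW + 5 / 6 * MW ^ 2 + 1 / 3 * MW * MZ + 1 / 6 * MZ ^ 2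

/-- Sup bound of `|N_Z|`. [folklore] -/
def supNZ (r MW MZ : ℝ) : ℝ := |r| * MZ + 1 / 3 * MW * MZ + 5 / 6 * MZ ^ 2 + 1 / 6 * MW ^ 2

/-- Sup bound of `|D_W|`. [folklore] -/
def supDW (MW MZ : ℝ) : ℝ := 1 + (2 * MW + MZ) / 3

/-- Sup bound of `|D_Z|`. [folklore] -/
def supDZ (MW MZ : ℝ) : ℝ := 1 + (MW + 2 * MZ) / 3

/-- Lipschitz constant of `N_W` on the tube set (sup norm). [folklore] -/
def lipNW (r MW MZ : ℝ) : ℝ := |r| + 2 * MW + 2 / 3 * MZ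

/-- Lipschitz constant of `N_Z`. [folklore] -/
def lipNZ (r MW MZ : ℝ) : ℝ := |r| + 2 / 3 * MW + 2 * MZ

/-- **The explicit Lipschitz constant of the complexified field on the tube set** (sup norm on `ℂ × ℂ`):
`K = max_i (sup|N_i|·1 + sup|D_i|·Lip(N_i)) / d_i²`. [folklore] -/
def lipK (r MW MZ dW dZ : ℝ) : ℝ :=
  max ((supNW r MW MZ + supDW MW MZ * lipNW r MW MZ) / dW ^ 2) ((supNZ r MW MZ + supDZ MW MZ * lipNZ r MW MZ) / dZ ^ 2)

section bounds

variable {r MW MZ : ℝ} {W Z W' Z' : ℂ}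

/-- [folklore] -/
theorem norm_cDW_le (hW : ‖W‖ ≤ MW) (hZ : ‖Z‖ ≤ MZ) : ‖cDW W Z‖ ≤ supDW MW MZ := by
  unfold cDW supDW
  calc ‖1 + (2 * W + Z) / 3‖ ≤ ‖(1 : ℂ)‖ + ‖(2 * W + Z) / 3‖ := norm_add_le _ _
    _ ≤ 1 + (2 * MW + MZ) / 3 := by
      rw [norm_one, norm_div, Complex.norm_ofNat]
      gcongr
      calc ‖2 * W + Z‖ ≤ ‖2 * W‖ + ‖Z‖ := norm_add_le _ _
        _ ≤ 2 * MW + MZ := by rw [norm_mul, Complex.norm_ofNat]; gcongr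

/-- [folklore] -/
theorem norm_cDZ_le (hW : ‖W‖ ≤ MW) (hZ : ‖Z‖ ≤ MZ) : ‖cDZ W Z‖ ≤ supDZ MW MZ := by
  unfold cDZ supDZ
  calc ‖1 + (W + 2 * Z) / 3‖ ≤ ‖(1 : ℂ)‖ + ‖(W + 2 * Z) / 3‖ := norm_add_le _ _
    _ ≤ 1 + (MW + 2 * MZ) / 3 := by
      rw [norm_one, norm_div, Complex.norm_ofNat]
      gcongr
      calc ‖W + 2 * Z‖ ≤ ‖W‖ + ‖2 * Z‖ := norm_add_le _ _
        _ ≤ MW + 2 * MZ := by rw [norm_mul, Complex.norm_ofNat]; gcongr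

/-- [folklore] -/
theorem norm_cNW_le (hW : ‖W‖ ≤ MW) (hZ : ‖Z‖ ≤ MZ) : ‖cNW r W Z‖ ≤ supNW r MW MZ := by
  have hMW : 0 ≤ MW := (norm_nonneg _).trans hW
  have hMZ : 0 ≤ MZ := (norm_nonneg _).trans hZ
  have e : cNW r W Z = -(r : ℂ) * W - 5 / 6 * (W * W) - 1 / 3 * (W * Z) + 1 / 6 * (Z * Z) := by unfold cNW; ring
  rw [e]
  have h1 : ‖-(r : ℂ) * W‖ ≤ |r| * MW := by
    rw [norm_mul, norm_neg, Complex.norm_real, Real.norm_eq_abs]; gcongr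
  have h2 : ‖(5 / 6 : ℂ) * (W * W)‖ ≤ 5 / 6 * MW ^ 2 := by
    rw [norm_mul, norm_mul, show ‖(5 / 6 : ℂ)‖ = 5 / 6 by norm_num, sq]; gcongr
  have h3 : ‖(1 / 3 : ℂ) * (W * Z)‖ ≤ 1 / 3 * MW * MZ := by
    rw [norm_mul, norm_mul, show ‖(1 / 3 : ℂ)‖ = 1 / 3 by norm_num, mul_assoc]; gcongr
  have h4 : ‖(1 / 6 : ℂ) * (Z * Z)‖ ≤ 1 / 6 * MZ ^ 2 := by
    rw [norm_mul, norm_mul, show ‖(1 / 6 : ℂ)‖ = 1 / 6 by norm_num, sq]; gcongr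
  unfold supNW
  calc ‖-(r : ℂ) * W - 5 / 6 * (W * W) - 1 / 3 * (W * Z) + 1 / 6 * (Z * Z)‖
      ≤ ‖-(r : ℂ) * W‖ + ‖(5 / 6 : ℂ) * (W * W)‖ + ‖(1 / 3 : ℂ) * (W * Z)‖ + ‖(1 / 6 : ℂ) * (Z * Z)‖ := by
        refine (norm_add_le _ _).trans (add_le_add ((norm_sub_le _ _).trans (add_le_add (norm_sub_le _ _) le_rfl)) le_rfl)
    _ ≤ |r| * MW + 5 / 6 * MW ^ 2 + 1 / 3 * MW * MZ + 1 / 6 * MZ ^ 2 := by linarith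

/-- [folklore] -/
theorem norm_cNZ_le (hW : ‖W‖ ≤ MW) (hZ : ‖Z‖ ≤ MZ) : ‖cNZ r W Z‖ ≤ supNZ r MW MZ := by
  have hMW : 0 ≤ MW := (norm_nonneg _).trans hW
  have hMZ : 0 ≤ MZ := (norm_nonneg _).trans hZ
  have e : cNZ r W Z = -(r : ℂ) * Z - 1 / 3 * (W * Z) - 5 / 6 * (Z * Z) + 1 / 6 * (W * W) := by unfold cNZ; ring
  rw [e]
  have h1 : ‖-(r : ℂ) * Z‖ ≤ |r| * MZ := by
    rw [norm_mul, norm_neg, Complex.norm_real, Real.norm_eq_abs]; gcongr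
  have h2 : ‖(1 / 3 : ℂ) * (W * Z)‖ ≤ 1 / 3 * MW * MZ := by
    rw [norm_mul, norm_mul, show ‖(1 / 3 : ℂ)‖ = 1 / 3 by norm_num, mul_assoc]; gcongr
  have h3 : ‖(5 / 6 : ℂ) * (Z * Z)‖ ≤ 5 / 6 * MZ ^ 2 := by
    rw [norm_mul, norm_mul, show ‖(5 / 6 : ℂ)‖ = 5 / 6 by norm_num, sq]; gcongr
  have h4 : ‖(1 / 6 : ℂ) * (W * W)‖ ≤ 1 / 6 * MW ^ 2 := by
    rw [norm_mul, norm_mul, show ‖(1 / 6 : ℂ)‖ = 1 / 6 by norm_num, sq]; gcongr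
  unfold supNZ
  calc ‖-(r : ℂ) * Z - 1 / 3 * (W * Z) - 5 / 6 * (Z * Z) + 1 / 6 * (W * W)‖
      ≤ ‖-(r : ℂ) * Z‖ + ‖(1 / 3 : ℂ) * (W * Z)‖ + ‖(5 / 6 : ℂ) * (Z * Z)‖ + ‖(1 / 6 : ℂ) * (W * W)‖ := by
        refine (norm_add_le _ _).trans (add_le_add ((norm_sub_le _ _).trans (add_le_add (norm_sub_le _ _) le_rfl)) le_rfl)
    _ ≤ |r| * MZ + 1 / 3 * MW * MZ + 5 / 6 * MZ ^ 2 + 1 / 6 * MW ^ 2 := by linarith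

/-- `|D_W(u) − D_W(v)| ≤ max(|ΔW|, |ΔZ|)`. [folklore] -/
theorem norm_cDW_sub_le (W Z W' Z' : ℂ) : ‖cDW W Z - cDW W' Z'‖ ≤ max ‖W - W'‖ ‖Z - Z'‖ := by
  have e : cDW W Z - cDW W' Z' = (2 * (W - W') + (Z - Z')) / 3 := by unfold cDW; ring
  rw [e, norm_div, Complex.norm_ofNat]
  have h1 : ‖W - W'‖ ≤ max ‖W - W'‖ ‖Z - Z'‖ := le_max_left _ _
  have h2 : ‖Z - Z'‖ ≤ max ‖W - W'‖ ‖Z - Z'‖ := le_max_right _ _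
  have h3 : ‖2 * (W - W') + (Z - Z')‖ ≤ 2 * ‖W - W'‖ + ‖Z - Z'‖ := by
    calc ‖2 * (W - W') + (Z - Z')‖ ≤ ‖2 * (W - W')‖ + ‖Z - Z'‖ := norm_add_le _ _
      _ = 2 * ‖W - W'‖ + ‖Z - Z'‖ := by rw [norm_mul, Complex.norm_ofNat]
  rw [div_le_iff₀ (by norm_num : (0 : ℝ) < 3)]
  linarith

/-- `|D_Z(u) − D_Z(v)| ≤ max(|ΔW|, |ΔZ|)`. [folklore] -/
theorem norm_cDZ_sub_le (W Z W' Z' : ℂ) : ‖cDZ W Z - cDZ W' Z'‖ ≤ max ‖W - W'‖ ‖Z - Z'‖ := by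
  have e : cDZ W Z - cDZ W' Z' = ((W - W') + 2 * (Z - Z')) / 3 := by unfold cDZ; ring
  rw [e, norm_div, Complex.norm_ofNat]
  have h1 : ‖W - W'‖ ≤ max ‖W - W'‖ ‖Z - Z'‖ := le_max_left _ _
  have h2 : ‖Z - Z'‖ ≤ max ‖W - W'‖ ‖Z - Z'‖ := le_max_right _ _
  have h3 : ‖(W - W') + 2 * (Z - Z')‖ ≤ ‖W - W'‖ + 2 * ‖Z - Z'‖ := by
    calc ‖(W - W') + 2 * (Z - Z')‖ ≤ ‖W - W'‖ + ‖2 * (Z - Z')‖ := norm_add_le _ _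
      _ = ‖W - W'‖ + 2 * ‖Z - Z'‖ := by rw [norm_mul, Complex.norm_ofNat]
  rw [div_le_iff₀ (by norm_num : (0 : ℝ) < 3)]
  linarith

/-- `|N_W(u) − N_W(v)| ≤ lipNW · max(|ΔW|, |ΔZ|)` on the tube set. [folklore] -/
theorem norm_cNW_sub_le (hW : ‖W‖ ≤ MW) (hZ : ‖Z‖ ≤ MZ) (hW' : ‖W'‖ ≤ MW) (hZ' : ‖Z'‖ ≤ MZ) :
    ‖cNW r W Z - cNW r W' Z'‖ ≤ lipNW r MW MZ * max ‖W - W'‖ ‖Z - Z'‖ := by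
  set m := max ‖W - W'‖ ‖Z - Z'‖ with hm
  have hm0 : 0 ≤ m := le_trans (norm_nonneg _) (le_max_left _ _)
  have h1 : ‖W - W'‖ ≤ m := le_max_left _ _
  have h2 : ‖Z - Z'‖ ≤ m := le_max_right _ _
  have hMW : 0 ≤ MW := (norm_nonneg _).trans hW
  have hMZ : 0 ≤ MZ := (norm_nonneg _).trans hZ
  -- `ΔN_W = −r ΔW − 5/6 (W + W′) ΔW − 1/3 (W ΔZ + Z′ ΔW) + 1/6 (Z + Z′) ΔZ`
  have e : cNW r W Z - cNW r W' Z' = (-(r : ℂ) - 5 / 6 * (W + W') - 1 / 3 * Z') * (W - W')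
      + (-(1 / 3) * W + 1 / 6 * (Z + Z')) * (Z - Z') := by unfold cNW; ring
  rw [e]
  have hA : ‖(-(r : ℂ) - 5 / 6 * (W + W') - 1 / 3 * Z')‖ ≤ |r| + 5 / 6 * (MW + MW) + 1 / 3 * MZ := by
    calc ‖(-(r : ℂ) - 5 / 6 * (W + W') - 1 / 3 * Z')‖ ≤ ‖-(r : ℂ)‖ + ‖(5 / 6 : ℂ) * (W + W')‖ + ‖(1 / 3 : ℂ) * Z'‖ :=
          (norm_sub_le _ _).trans (add_le_add (norm_sub_le _ _) le_rfl)
      _ ≤ |r| + 5 / 6 * (MW + MW) + 1 / 3 * MZ := by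
          rw [norm_neg, Complex.norm_real, Real.norm_eq_abs, norm_mul, norm_mul,
            show ‖(5 / 6 : ℂ)‖ = 5 / 6 by norm_num, show ‖(1 / 3 : ℂ)‖ = 1 / 3 by norm_num]
          gcongr
          exact (norm_add_le _ _).trans (add_le_add hW hW')
  have hB : ‖(-(1 / 3) * W + 1 / 6 * (Z + Z'))‖ ≤ 1 / 3 * MW + 1 / 6 * (MZ + MZ) := by
    calc ‖(-(1 / 3) * W + 1 / 6 * (Z + Z'))‖ ≤ ‖(-(1 / 3) : ℂ) * W‖ + ‖(1 / 6 : ℂ) * (Z + Z')‖ := norm_add_le _ _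
      _ ≤ 1 / 3 * MW + 1 / 6 * (MZ + MZ) := by
          rw [norm_mul, norm_mul, show ‖(-(1 / 3) : ℂ)‖ = 1 / 3 by norm_num, show ‖(1 / 6 : ℂ)‖ = 1 / 6 by norm_num]
          gcongr
          exact (norm_add_le _ _).trans (add_le_add hZ hZ')
  unfold lipNW
  calc ‖(-(r : ℂ) - 5 / 6 * (W + W') - 1 / 3 * Z') * (W - W') + (-(1 / 3) * W + 1 / 6 * (Z + Z')) * (Z - Z')‖
      ≤ ‖(-(r : ℂ) - 5 / 6 * (W + W') - 1 / 3 * Z')‖ * ‖W - W'‖ + ‖(-(1 / 3) * W + 1 / 6 * (Z + Z'))‖ * ‖Z - Z'‖ := by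
        refine (norm_add_le _ _).trans ?_; rw [norm_mul, norm_mul]
    _ ≤ (|r| + 5 / 6 * (MW + MW) + 1 / 3 * MZ) * m + (1 / 3 * MW + 1 / 6 * (MZ + MZ)) * m := by
        gcongr
    _ = (|r| + 2 * MW + 2 / 3 * MZ) * m := by ring

/-- `|N_Z(u) − N_Z(v)| ≤ lipNZ · max(|ΔW|, |ΔZ|)` on the tube set. [folklore] -/
theorem norm_cNZ_sub_le (hW : ‖W‖ ≤ MW) (hZ : ‖Z‖ ≤ MZ) (hW' : ‖W'‖ ≤ MW) (hZ' : ‖Z'‖ ≤ MZ) :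
    ‖cNZ r W Z - cNZ r W' Z'‖ ≤ lipNZ r MW MZ * max ‖W - W'‖ ‖Z - Z'‖ := by
  set m := max ‖W - W'‖ ‖Z - Z'‖ with hm
  have hm0 : 0 ≤ m := le_trans (norm_nonneg _) (le_max_left _ _)
  have h1 : ‖W - W'‖ ≤ m := le_max_left _ _
  have h2 : ‖Z - Z'‖ ≤ m := le_max_right _ _
  have hMW : 0 ≤ MW := (norm_nonneg _).trans hW
  have hMZ : 0 ≤ MZ := (norm_nonneg _).trans hZ
  -- `ΔN_Z = −r ΔZ − 1/3 (W ΔZ + Z′ ΔW) − 5/6 (Z + Z′) ΔZ + 1/6 (W + W′) ΔW`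
  have e : cNZ r W Z - cNZ r W' Z' = (-(1 / 3) * Z' + 1 / 6 * (W + W')) * (W - W')
      + (-(r : ℂ) - 1 / 3 * W - 5 / 6 * (Z + Z')) * (Z - Z') := by unfold cNZ; ring
  rw [e]
  have hA : ‖(-(1 / 3) * Z' + 1 / 6 * (W + W'))‖ ≤ 1 / 3 * MZ + 1 / 6 * (MW + MW) := by
    calc ‖(-(1 / 3) * Z' + 1 / 6 * (W + W'))‖ ≤ ‖(-(1 / 3) : ℂ) * Z'‖ + ‖(1 / 6 : ℂ) * (W + W')‖ := norm_add_le _ _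
      _ ≤ 1 / 3 * MZ + 1 / 6 * (MW + MW) := by
          rw [norm_mul, norm_mul, show ‖(-(1 / 3) : ℂ)‖ = 1 / 3 by norm_num, show ‖(1 / 6 : ℂ)‖ = 1 / 6 by norm_num]
          gcongr
          exact (norm_add_le _ _).trans (add_le_add hW hW')
  have hB : ‖(-(r : ℂ) - 1 / 3 * W - 5 / 6 * (Z + Z'))‖ ≤ |r| + 1 / 3 * MW + 5 / 6 * (MZ + MZ) := by
    calc ‖(-(r : ℂ) - 1 / 3 * W - 5 / 6 * (Z + Z'))‖ ≤ ‖-(r : ℂ)‖ + ‖(1 / 3 : ℂ) * W‖ + ‖(5 / 6 : ℂ) * (Z + Z')‖ :=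
          (norm_sub_le _ _).trans (add_le_add (norm_sub_le _ _) le_rfl)
      _ ≤ |r| + 1 / 3 * MW + 5 / 6 * (MZ + MZ) := by
          rw [norm_neg, Complex.norm_real, Real.norm_eq_abs, norm_mul, norm_mul,
            show ‖(1 / 3 : ℂ)‖ = 1 / 3 by norm_num, show ‖(5 / 6 : ℂ)‖ = 5 / 6 by norm_num]
          gcongr
          exact (norm_add_le _ _).trans (add_le_add hZ hZ')
  unfold lipNZ
  calc ‖(-(1 / 3) * Z' + 1 / 6 * (W + W')) * (W - W') + (-(r : ℂ) - 1 / 3 * W - 5 / 6 * (Z + Z')) * (Z - Z')‖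
      ≤ ‖(-(1 / 3) * Z' + 1 / 6 * (W + W'))‖ * ‖W - W'‖ + ‖(-(r : ℂ) - 1 / 3 * W - 5 / 6 * (Z + Z'))‖ * ‖Z - Z'‖ := by
        refine (norm_add_le _ _).trans ?_; rw [norm_mul, norm_mul]
    _ ≤ (1 / 3 * MZ + 1 / 6 * (MW + MW)) * m + (|r| + 1 / 3 * MW + 5 / 6 * (MZ + MZ)) * m := by
        gcongr
    _ = (|r| + 2 / 3 * MW + 2 * MZ) * m := by ring

/-- The quotient estimate: `|N₁/D₁ − N₂/D₂| ≤ (|N₁|·|D₁ − D₂| + |D₁|·|N₁ − N₂|)/(d·d)` when `|D₁|, |D₂| ≥ d > 0`. [folklore] -/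
theorem norm_div_sub_div_le {N₁ N₂ D₁ D₂ : ℂ} {d MN MD a b : ℝ} (hd : 0 < d) (hD₁ : d ≤ ‖D₁‖) (hD₂ : d ≤ ‖D₂‖)
    (hN : ‖N₁‖ ≤ MN) (hMD : ‖D₁‖ ≤ MD) (ha : ‖D₁ - D₂‖ ≤ a) (hb : ‖N₁ - N₂‖ ≤ b) :
    ‖N₁ / D₁ - N₂ / D₂‖ ≤ (MN * a + MD * b) / d ^ 2 := by
  have hD₁0 : D₁ ≠ 0 := fun h => by rw [h, norm_zero] at hD₁; linarith
  have hD₂0 : D₂ ≠ 0 := fun h => by rw [h, norm_zero] at hD₂; linarith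
  have e : N₁ / D₁ - N₂ / D₂ = (N₁ * (D₂ - D₁) + D₁ * (N₁ - N₂)) / (D₁ * D₂) := by field_simp; ring
  rw [e, norm_div, norm_mul]
  have hnum : ‖N₁ * (D₂ - D₁) + D₁ * (N₁ - N₂)‖ ≤ MN * a + MD * b := by
    calc ‖N₁ * (D₂ - D₁) + D₁ * (N₁ - N₂)‖ ≤ ‖N₁‖ * ‖D₂ - D₁‖ + ‖D₁‖ * ‖N₁ - N₂‖ := by
          refine (norm_add_le _ _).trans ?_; rw [norm_mul, norm_mul]
      _ ≤ MN * a + MD * b := by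
          rw [norm_sub_rev] at ha
          have hMN : 0 ≤ MN := (norm_nonneg _).trans hN
          have hMD : 0 ≤ MD := (norm_nonneg _).trans hMD
          gcongr
  have hden : d ^ 2 ≤ ‖D₁‖ * ‖D₂‖ := by rw [sq]; exact mul_le_mul hD₁ hD₂ hd.le (norm_nonneg _)
  have hnum0 : 0 ≤ MN * a + MD * b := (norm_nonneg _).trans hnum
  calc ‖N₁ * (D₂ - D₁) + D₁ * (N₁ - N₂)‖ / (‖D₁‖ * ‖D₂‖) ≤ (MN * a + MD * b) / (‖D₁‖ * ‖D₂‖) := by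
        gcongr
    _ ≤ (MN * a + MD * b) / d ^ 2 := div_le_div_of_nonneg_left hnum0 (by positivity) hden

end bounds

/-- **Lipschitz bound of the complexified field on the tube set** (sup norm of `ℂ × ℂ`):
`‖F(u) − F(v)‖ ≤ lipK · ‖u − v‖`. [cite: Hille1976, §2.3] -/
theorem lipschitz_cfield {r MW MZ dW dZ : ℝ} (hdW : 0 < dW) (hdZ : 0 < dZ) :
    ∀ u ∈ tubeSet MW MZ dW dZ, ∀ v ∈ tubeSet MW MZ dW dZ, ‖cfield r u - cfield r v‖ ≤ lipK r MW MZ dW dZ * ‖u - v‖ := by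
  intro u hu v hv
  obtain ⟨huW, huZ, huDW, huDZ⟩ := hu
  obtain ⟨hvW, hvZ, hvDW, hvDZ⟩ := hv
  have hm : max ‖u.1 - v.1‖ ‖u.2 - v.2‖ = ‖u - v‖ := by rw [Prod.norm_def]; rfl
  have h1 : ‖cNW r u.1 u.2 / cDW u.1 u.2 - cNW r v.1 v.2 / cDW v.1 v.2‖ ≤
      (supNW r MW MZ + supDW MW MZ * lipNW r MW MZ) / dW ^ 2 * ‖u - v‖ := by
    have h := norm_div_sub_div_le (N₁ := cNW r u.1 u.2) (N₂ := cNW r v.1 v.2) hdW huDW hvDW (norm_cNW_le (r := r) huW huZ)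
      (norm_cDW_le huW huZ) (norm_cDW_sub_le u.1 u.2 v.1 v.2) (norm_cNW_sub_le (r := r) huW huZ hvW hvZ)
    rw [hm] at h
    calc _ ≤ (supNW r MW MZ * ‖u - v‖ + supDW MW MZ * (lipNW r MW MZ * ‖u - v‖)) / dW ^ 2 := h
      _ = (supNW r MW MZ + supDW MW MZ * lipNW r MW MZ) / dW ^ 2 * ‖u - v‖ := by ring
  have h2 : ‖cNZ r u.1 u.2 / cDZ u.1 u.2 - cNZ r v.1 v.2 / cDZ v.1 v.2‖ ≤
      (supNZ r MW MZ + supDZ MW MZ * lipNZ r MW MZ) / dZ ^ 2 * ‖u - v‖ := by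
    have h := norm_div_sub_div_le (N₁ := cNZ r u.1 u.2) (N₂ := cNZ r v.1 v.2) hdZ huDZ hvDZ (norm_cNZ_le (r := r) huW huZ)
      (norm_cDZ_le huW huZ) (norm_cDZ_sub_le u.1 u.2 v.1 v.2) (norm_cNZ_sub_le (r := r) huW huZ hvW hvZ)
    rw [hm] at h
    calc _ ≤ (supNZ r MW MZ * ‖u - v‖ + supDZ MW MZ * (lipNZ r MW MZ * ‖u - v‖)) / dZ ^ 2 := h
      _ = (supNZ r MW MZ + supDZ MW MZ * lipNZ r MW MZ) / dZ ^ 2 * ‖u - v‖ := by ring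
  have e : cfield r u - cfield r v = (cNW r u.1 u.2 / cDW u.1 u.2 - cNW r v.1 v.2 / cDW v.1 v.2,
      cNZ r u.1 u.2 / cDZ u.1 u.2 - cNZ r v.1 v.2 / cDZ v.1 v.2) := rfl
  rw [e, Prod.norm_def]
  refine max_le (h1.trans ?_) (h2.trans ?_)
  · exact mul_le_mul_of_nonneg_right (le_max_left _ _) (norm_nonneg _)
  · exact mul_le_mul_of_nonneg_right (le_max_right _ _) (norm_nonneg _)

/-- `lipK ≥ 0` when the inputs are. [folklore] -/
theorem lipK_nonneg {r MW MZ dW dZ : ℝ} (hMW : 0 ≤ MW) (hMZ : 0 ≤ MZ) : 0 ≤ lipK r MW MZ dW dZ := by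
  unfold lipK supNW supDW lipNW
  refine le_max_of_le_left ?_
  have : 0 ≤ |r| := abs_nonneg r
  positivity

/-! ### Membership of a tube ball in the tube set -/

/-- A closed sup-norm ball around a point `(W, Z)` with `|W| + γ ≤ M_W`, `|Z| + γ ≤ M_Z`, `|D_W(W,Z)| − γ ≥ d_W`, `|D_Z(W,Z)| − γ ≥ d_Z`
lies in the tube set. [folklore] -/
theorem closedBall_subset_tubeSet {W Z : ℂ} {γ MW MZ dW dZ : ℝ} (hW : ‖W‖ + γ ≤ MW) (hZ : ‖Z‖ + γ ≤ MZ)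
    (hDW : dW ≤ ‖cDW W Z‖ - γ) (hDZ : dZ ≤ ‖cDZ W Z‖ - γ) :
    closedBall ((W, Z) : ℂ × ℂ) γ ⊆ tubeSet MW MZ dW dZ := by
  intro p hp
  rw [mem_closedBall, dist_eq_norm, Prod.norm_def] at hp
  have h1 : ‖p.1 - W‖ ≤ γ := le_trans (le_max_left _ _) hp
  have h2 : ‖p.2 - Z‖ ≤ γ := le_trans (le_max_right _ _) hp
  have hmax : max ‖p.1 - W‖ ‖p.2 - Z‖ ≤ γ := hp
  refine ⟨?_, ?_, ?_, ?_⟩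
  · calc ‖p.1‖ = ‖(p.1 - W) + W‖ := by rw [sub_add_cancel]
      _ ≤ ‖p.1 - W‖ + ‖W‖ := norm_add_le _ _
      _ ≤ MW := by linarith
  · calc ‖p.2‖ = ‖(p.2 - Z) + Z‖ := by rw [sub_add_cancel]
      _ ≤ ‖p.2 - Z‖ + ‖Z‖ := norm_add_le _ _
      _ ≤ MZ := by linarith
  · have h := norm_cDW_sub_le p.1 p.2 W Z
    have h' : ‖cDW W Z‖ - ‖cDW p.1 p.2 - cDW W Z‖ ≤ ‖cDW p.1 p.2‖ := by
      have := norm_sub_norm_le (cDW W Z) (cDW p.1 p.2)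
      rw [norm_sub_rev] at this
      linarith [abs_norm_sub_norm_le (cDW W Z) (cDW p.1 p.2), norm_sub_le (cDW W Z) (cDW p.1 p.2)]
    linarith
  · have h := norm_cDZ_sub_le p.1 p.2 W Z
    have h' : ‖cDZ W Z‖ - ‖cDZ p.1 p.2 - cDZ W Z‖ ≤ ‖cDZ p.1 p.2‖ := by
      linarith [norm_sub_le (cDZ W Z) (cDZ p.1 p.2), norm_sub_norm_le (cDZ W Z) (cDZ p.1 p.2),
        norm_sub_rev (cDZ p.1 p.2) (cDZ W Z)]
    linarith

end ComplexDisc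

end Monatomic

end BuckmasterCaolaboraGomezserrano2025

end Literature.Analysis.FluidPDE
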